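import Literature.NumberTheory.LFunctions.DirichletPolynomialMeanValue
import Mathlib.MeasureTheory.Integral.IntervalIntegral.FundThmCalculus
import HarnessLib

/-!
# The discrete mean value theorem for Dirichlet polynomials (Gallagher's lemma)

Trunk T-ANT, topic `Literature/NumberTheory/LFunctions`. This file PROVES the named fact
`Literature.NumberTheory.LFunctions.MatomakiRadziwill2016_lemma7` of `DirichletPolynomialMeanValue.lean`
(Matomäki–Radziwiłł 2016, Lemma 7 = Ivić 1985, Thm 5.3 in the form `≪ (T + N) log 2N ∑|a_n|²`):
for a finite set `𝒯 ⊂ [-T, T]` of reals pairwise `≥ 1` apart, `N ≥ 1`, `T ≥ 1`,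

  `∑_{t ∈ 𝒯} |∑_{n ≤ N} a_n n^{-it}|² ≤ 72 (T + N) log(2N) ∑_{n ≤ N} |a_n|²`.

The proof is the printed one (Ivić 1985, proof of Thm 5.3, (5.15)–(5.18)): the Sobolev–Gallagher
inequality `|f(x)| ≤ ∫_{x-1/2}^{x+1/2} (|f| + |f'|)` applied to `f = A²`,
`A(t) = ∑ a_n n^{-it}`, `f' = 2 A A'` with `A'(t) = ∑ (-i log n) a_n n^{-it}`; the windows
`(t - 1/2, t + 1/2]`, `t ∈ 𝒯`, are disjoint and lie in `(-(T+1), T+1]`; `2|A||A'| ≤ L|A|² + |A'|²/L`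
with `L = log 2N`; and the (weak, explicit) integral mean value theorem of the tree,
`∫_{-T}^{T} |∑ a_n n^{-it}|² ≤ (5T + 18N) ∑ |a_n|²` (`Literature.NumberTheory.LFunctions.dirichletPolynomial_meanSquare_le`),
applied to `a_n` and to `a_n log n`.

## Main results

* `Literature.NumberTheory.LFunctions.norm_le_integral_add_integral_deriv` : Gallagher's pointwise inequality (Ivić (5.15)–(5.16),
  with the constant `1/2` in front of `∫|f'|` relaxed to `1`).
* `Literature.NumberTheory.LFunctions.sum_norm_sq_dirichletPoly_le` : the discrete mean value theorem with the explicit constant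
  `72`.
* `Literature.MatomakiRadziwill2016_lemma7_holds : MatomakiRadziwill2016_lemma7`.

## References

* A. Ivić, *The Riemann zeta-function*, Wiley 1985, Thm 5.3 and its proof, (5.14)–(5.18).
* K. Matomäki, M. Radziwiłł, Ann. of Math. 183 (2016), Lemma 7.
* P. X. Gallagher, *A large sieve density estimate near σ = 1*, Invent. Math. 11 (1970), Lemma 1.
-/

noncomputable section

open Finset Real MeasureTheory Complex Set intervalIntegral

namespace Literature.NumberTheory.LFunctions

/-! ### Gallagher's pointwise inequality -/

/-- **Gallagher's (Sobolev) inequality on a unit window** (Ivić 1985, (5.15)–(5.16), constant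
relaxed): if `f : ℝ → ℂ` has the continuous derivative `f'` everywhere, then
`‖f x‖ ≤ ∫_{x-1/2}^{x+1/2} ‖f‖ + ∫_{x-1/2}^{x+1/2} ‖f'‖`. [cite: Ivic1985, (5.15)–(5.16)] -/
theorem norm_le_integral_add_integral_deriv {f f' : ℝ → ℂ} (hf : ∀ u, HasDerivAt f (f' u) u)
    (hf' : Continuous f') (x : ℝ) :
    ‖f x‖ ≤ (∫ u in (x - 1 / 2)..(x + 1 / 2), ‖f u‖) +
      ∫ u in (x - 1 / 2)..(x + 1 / 2), ‖f' u‖ := by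
  have hfc : Continuous f := continuous_iff_continuousAt.2 fun u ↦ (hf u).continuousAt
  set K : ℝ := ∫ u in (x - 1 / 2)..(x + 1 / 2), ‖f' u‖ with hK
  have hab : x - 1 / 2 ≤ x + 1 / 2 := by linarith
  -- pointwise: ‖f x‖ ≤ ‖f u‖ + K on the window
  have hpt : ∀ u ∈ Set.Icc (x - 1 / 2) (x + 1 / 2), ‖f x‖ ≤ ‖f u‖ + K := by
    intro u hu
    have hFTC : ∫ v in u..x, f' v = f x - f u :=
      integral_eq_sub_of_hasDerivAt (fun v _ ↦ hf v) (hf'.intervalIntegrable _ _)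
    have h1 : ‖f x - f u‖ ≤ K := by
      rw [← hFTC]
      calc ‖∫ v in u..x, f' v‖ ≤ |∫ v in u..x, ‖f' v‖| :=
            norm_integral_le_abs_integral_norm
        _ ≤ K := by
          rw [hK]
          rcases le_total u x with hux | hux
          · rw [abs_of_nonneg (integral_nonneg hux fun v _ ↦ norm_nonneg _)]
            exact integral_mono_interval hu.1 hux (by linarith)
              (Filter.Eventually.of_forall fun v ↦ norm_nonneg _)
              (hf'.norm.intervalIntegrable _ _)
          · rw [integral_symm, abs_neg,
              abs_of_nonneg (integral_nonneg hux fun v _ ↦ norm_nonneg _)]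
            exact integral_mono_interval (by linarith) hux hu.2
              (Filter.Eventually.of_forall fun v ↦ norm_nonneg _)
              (hf'.norm.intervalIntegrable _ _)
    calc ‖f x‖ = ‖f u + (f x - f u)‖ := by ring_nf
      _ ≤ ‖f u‖ + ‖f x - f u‖ := norm_add_le _ _
      _ ≤ ‖f u‖ + K := by linarith
  -- integrate over the window (length 1)
  have hint : ∫ u in (x - 1 / 2)..(x + 1 / 2), ‖f x‖ ≤
      ∫ u in (x - 1 / 2)..(x + 1 / 2), (‖f u‖ + K) :=
    integral_mono_on hab intervalIntegrable_const
      ((hfc.norm.add continuous_const).intervalIntegrable _ _) hpt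
  rw [intervalIntegral.integral_const, intervalIntegral.integral_add (hfc.norm.intervalIntegrable _ _)
    intervalIntegrable_const, intervalIntegral.integral_const] at hint
  simp only [add_sub_sub_cancel, smul_eq_mul] at hint
  norm_num at hint
  linarith

/-! ### Sums of window integrals over well-spaced points -/

/-- For a finite set `𝒯 ⊂ [-T, T]` of reals pairwise `≥ 1` apart and `g ≥ 0` continuous, the unit
windows `(t - 1/2, t + 1/2]`, `t ∈ 𝒯`, are disjoint and lie in `(-(T+1), T+1]`, so
`∑_{t ∈ 𝒯} ∫_{t-1/2}^{t+1/2} g ≤ ∫_{-(T+1)}^{T+1} g` (Ivić 1985, proof of Thm 5.3, (5.17)).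
[cite: Ivic1985, proof of Theorem 5.3, (5.17)] -/
theorem sum_integral_window_le {g : ℝ → ℝ} (hg : Continuous g) (hg0 : ∀ u, 0 ≤ g u) {T : ℝ}
    (hT : 0 ≤ T) (𝒯 : Finset ℝ) (h𝒯 : ∀ t ∈ 𝒯, |t| ≤ T)
    (hsep : ∀ t ∈ 𝒯, ∀ t' ∈ 𝒯, t ≠ t' → 1 ≤ |t - t'|) :
    ∑ t ∈ 𝒯, ∫ u in (t - 1 / 2)..(t + 1 / 2), g u ≤ ∫ u in (-(T + 1))..(T + 1), g u := by
  have hwin : ∀ t ∈ 𝒯, ∫ u in (t - 1 / 2)..(t + 1 / 2), g u =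
      ∫ u in Set.Ioc (t - 1 / 2) (t + 1 / 2), g u := fun t _ ↦
    integral_of_le (by linarith)
  rw [Finset.sum_congr rfl hwin, integral_of_le (by linarith),
    ← integral_biUnion_finset 𝒯 (fun t _ ↦ measurableSet_Ioc) ?_
      (fun t _ ↦ hg.integrableOn_Ioc)]
  · have hsub : (⋃ t ∈ 𝒯, Set.Ioc (t - 1 / 2) (t + 1 / 2)) ≤ Set.Ioc (-(T + 1)) (T + 1) := by
      intro u hu
      simp only [Set.mem_iUnion, Set.mem_Ioc, exists_prop] at hu
      obtain ⟨t, ht, h1, h2⟩ := hu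
      have h3 := abs_le.1 (h𝒯 t ht)
      exact ⟨by linarith, by linarith⟩
    exact setIntegral_mono_set hg.integrableOn_Ioc
      (Filter.Eventually.of_forall fun u ↦ hg0 u) hsub.eventuallyLE
  · intro t ht t' ht' hne
    have h := hsep t ht t' ht' hne
    change Disjoint (Set.Ioc (t - 1 / 2) (t + 1 / 2)) (Set.Ioc (t' - 1 / 2) (t' + 1 / 2))
    rw [Set.Ioc_disjoint_Ioc]
    rcases le_or_gt t t' with htt | htt
    · have : 1 ≤ t' - t := by
        have := abs_sub_comm t t' ▸ h
        rwa [abs_of_nonneg (by linarith)] at this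
      rw [min_eq_left (by linarith), max_eq_right (by linarith)]
      linarith
    · rw [abs_of_pos (by linarith)] at h
      rw [min_eq_right (by linarith), max_eq_left (by linarith)]
      linarith

/-! ### Dirichlet polynomials: derivative in `t` -/

/-- `d/dt n^{-it} = n^{-it} · (-i log n)` for `n ≥ 1`. [folklore] -/
theorem hasDerivAt_natCast_cpow_neg_mul_I {n : ℕ} (hn : n ≠ 0) (t : ℝ) :
    HasDerivAt (fun y : ℝ ↦ (n : ℂ) ^ (-((y : ℂ) * I)))
      ((n : ℂ) ^ (-((t : ℂ) * I)) * (-(Real.log n : ℂ) * I)) t := by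
  have hnC : (n : ℂ) ≠ 0 := Nat.cast_ne_zero.2 hn
  have h1 : HasDerivAt (fun w : ℂ ↦ -(w * I)) (-I) (t : ℂ) := by
    simpa using ((hasDerivAt_id (t : ℂ)).mul_const I).fun_neg
  have h2 := h1.const_cpow (c := (n : ℂ)) (Or.inl hnC)
  have h3 := h2.comp_ofReal
  rw [← Complex.natCast_log] at h3
  refine h3.congr_deriv ?_
  push_cast
  simp only [neg_mul, mul_neg, mul_assoc]

/-- Continuity of `t ↦ n^{-it}` (`n ≥ 1`). [folklore] -/
theorem continuous_natCast_cpow_neg_mul_I {n : ℕ} (hn : n ≠ 0) :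
    Continuous fun y : ℝ ↦ (n : ℂ) ^ (-((y : ℂ) * I)) :=
  continuous_iff_continuousAt.2 fun t ↦ (hasDerivAt_natCast_cpow_neg_mul_I hn t).continuousAt

/-- A Dirichlet polynomial `A(t) = ∑_{n ≤ N} a_n n^{-it}` is continuous in `t`. [folklore] -/
theorem DirichletPolynomialDiscreteMeanValue.continuous_dirichletPoly (a : ℕ → ℂ) (N : ℕ) :
    Continuous fun t : ℝ ↦ ∑ n ∈ Finset.Icc 1 N, a n * (n : ℂ) ^ (-((t : ℂ) * I)) := by
  refine continuous_finsetSum _ fun n hn ↦ ?_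
  have hn0 : n ≠ 0 := by simp only [Finset.mem_Icc] at hn; omega
  exact continuous_const.mul (continuous_natCast_cpow_neg_mul_I hn0)

/-- The `t`-derivative of `A(t) = ∑_{n ≤ N} a_n n^{-it}` is the Dirichlet polynomial with
coefficients `a_n · (-i log n)`. [folklore] -/
theorem hasDerivAt_dirichletPoly (a : ℕ → ℂ) (N : ℕ) (t : ℝ) :
    HasDerivAt (fun y : ℝ ↦ ∑ n ∈ Finset.Icc 1 N, a n * (n : ℂ) ^ (-((y : ℂ) * I)))
      (∑ n ∈ Finset.Icc 1 N, (a n * (-(Real.log n : ℂ) * I)) * (n : ℂ) ^ (-((t : ℂ) * I))) t := by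
  refine HasDerivAt.fun_sum fun n hn ↦ ?_
  have hn0 : n ≠ 0 := by simp only [Finset.mem_Icc] at hn; omega
  exact ((hasDerivAt_natCast_cpow_neg_mul_I hn0 t).const_mul (a n)).congr_deriv (by ring)

/-! ### The discrete mean value theorem -/

/-- **Discrete mean value theorem for Dirichlet polynomials** (Ivić 1985 Thm 5.3;
Matomäki–Radziwiłł 2016 Lemma 7), explicit form: for `N ≥ 1`, `T ≥ 1`, a finite set `𝒯 ⊂ [-T, T]`
of reals pairwise `≥ 1` apart and any complex `a_n`,
`∑_{t∈𝒯} |∑_{n≤N} a_n n^{-it}|² ≤ 72 (T + N) log(2N) ∑_{n≤N} |a_n|²`.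
Proof: Gallagher's inequality for `A²` on the disjoint windows, `2|A||A'| ≤ L|A|² + |A'|²/L`
(`L = log 2N`), and the integral mean value theorem `Literature.NumberTheory.LFunctions.dirichletPolynomial_meanSquare_le` for `A`
and `A'`. [cite: Ivic1985, Theorem 5.3] -/
theorem sum_norm_sq_dirichletPoly_le (N : ℕ) (a : ℕ → ℂ) (T : ℝ) (𝒯 : Finset ℝ) (hN : 1 ≤ N)
    (hT : 1 ≤ T) (h𝒯 : ∀ t ∈ 𝒯, |t| ≤ T)
    (hsep : ∀ t ∈ 𝒯, ∀ t' ∈ 𝒯, t ≠ t' → 1 ≤ |t - t'|) :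
    ∑ t ∈ 𝒯, ‖∑ n ∈ Finset.Icc 1 N, a n * (n : ℂ) ^ (-((t : ℂ) * I))‖ ^ 2 ≤
      72 * (T + N) * Real.log (2 * N) * ∑ n ∈ Finset.Icc 1 N, ‖a n‖ ^ 2 := by
  -- notation
  set A : ℝ → ℂ := fun t ↦ ∑ n ∈ Finset.Icc 1 N, a n * (n : ℂ) ^ (-((t : ℂ) * I)) with hA
  set b : ℕ → ℂ := fun n ↦ a n * (-(Real.log n : ℂ) * I) with hb
  set B : ℝ → ℂ := fun t ↦ ∑ n ∈ Finset.Icc 1 N, b n * (n : ℂ) ^ (-((t : ℂ) * I)) with hB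
  set S : ℝ := ∑ n ∈ Finset.Icc 1 N, ‖a n‖ ^ 2 with hS
  set L : ℝ := Real.log (2 * N) with hL
  set M : ℝ := 5 * (T + 1) + 18 * N with hM
  have hN' : (1 : ℝ) ≤ N := by exact_mod_cast hN
  have hS0 : 0 ≤ S := Finset.sum_nonneg fun n _ ↦ by positivity
  have hlog2 : (1 : ℝ) / 2 < Real.log 2 := by linarith [Real.log_two_gt_d9]
  have hLge : Real.log 2 ≤ L := Real.log_le_log (by norm_num) (by linarith)
  have hL0 : 0 < L := by linarith
  have hlogN : 0 ≤ Real.log N := Real.log_nonneg hN'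
  have hlogNL : Real.log N ≤ L := Real.log_le_log (by linarith) (by linarith)
  have hM0 : 0 < M := by rw [hM]; positivity
  -- continuity and derivative
  have hcA : Continuous A := DirichletPolynomialDiscreteMeanValue.continuous_dirichletPoly a N
  have hcB : Continuous B := DirichletPolynomialDiscreteMeanValue.continuous_dirichletPoly b N
  have hdA : ∀ t, HasDerivAt A (B t) t := fun t ↦ hasDerivAt_dirichletPoly a N t
  have hdF : ∀ t, HasDerivAt (fun y ↦ A y * A y) (B t * A t + A t * B t) t :=
    fun t ↦ (hdA t).mul (hdA t)
  have hcF' : Continuous fun t ↦ B t * A t + A t * B t := by fun_prop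
  -- Gallagher on each window, then AM–GM
  have hG : ∀ t : ℝ, ‖A t‖ ^ 2 ≤ (1 + L) * (∫ u in (t - 1 / 2)..(t + 1 / 2), ‖A u‖ ^ 2) +
      L⁻¹ * ∫ u in (t - 1 / 2)..(t + 1 / 2), ‖B u‖ ^ 2 := by
    intro t
    have h1 := norm_le_integral_add_integral_deriv hdF hcF' t
    have h2 : ∫ u in (t - 1 / 2)..(t + 1 / 2), ‖B u * A u + A u * B u‖ ≤
        ∫ u in (t - 1 / 2)..(t + 1 / 2), (L * ‖A u‖ ^ 2 + L⁻¹ * ‖B u‖ ^ 2) := by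
      refine integral_mono_on (by linarith) (hcF'.norm.intervalIntegrable _ _)
        (Continuous.intervalIntegrable (by fun_prop) _ _) fun u _ ↦ ?_
      have hx : 0 ≤ ‖A u‖ := norm_nonneg _
      have hy : 0 ≤ ‖B u‖ := norm_nonneg _
      calc ‖B u * A u + A u * B u‖ ≤ ‖B u * A u‖ + ‖A u * B u‖ := norm_add_le _ _
        _ = 2 * (‖A u‖ * ‖B u‖) := by rw [norm_mul, norm_mul]; ring
        _ ≤ L * ‖A u‖ ^ 2 + L⁻¹ * ‖B u‖ ^ 2 := by
          have key : 0 ≤ (L * ‖A u‖ - ‖B u‖) ^ 2 / L := by positivity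
          have e : (L * ‖A u‖ - ‖B u‖) ^ 2 / L =
              L * ‖A u‖ ^ 2 + L⁻¹ * ‖B u‖ ^ 2 - 2 * (‖A u‖ * ‖B u‖) := by
            field_simp
            ring
          linarith
    have h3 : ∫ u in (t - 1 / 2)..(t + 1 / 2), (L * ‖A u‖ ^ 2 + L⁻¹ * ‖B u‖ ^ 2) =
        L * (∫ u in (t - 1 / 2)..(t + 1 / 2), ‖A u‖ ^ 2) +
          L⁻¹ * ∫ u in (t - 1 / 2)..(t + 1 / 2), ‖B u‖ ^ 2 := by
      rw [intervalIntegral.integral_add (Continuous.intervalIntegrable (by fun_prop) _ _)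
        (Continuous.intervalIntegrable (by fun_prop) _ _), intervalIntegral.integral_const_mul,
        intervalIntegral.integral_const_mul]
    have h4 : ∫ u in (t - 1 / 2)..(t + 1 / 2), ‖A u * A u‖ =
        ∫ u in (t - 1 / 2)..(t + 1 / 2), ‖A u‖ ^ 2 := by
      refine intervalIntegral.integral_congr fun u _ ↦ ?_
      simp only [norm_mul]
      ring
    rw [norm_mul, ← sq, h4] at h1
    linarith
  -- sum over the windows
  have hT0 : 0 ≤ T := by linarith
  have hwA := sum_integral_window_le (g := fun u ↦ ‖A u‖ ^ 2) (by fun_prop)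
    (fun u ↦ by positivity) hT0 𝒯 h𝒯 hsep
  have hwB := sum_integral_window_le (g := fun u ↦ ‖B u‖ ^ 2) (by fun_prop)
    (fun u ↦ by positivity) hT0 𝒯 h𝒯 hsep
  -- the integral mean value theorem on `(-(T+1), T+1]`
  have hMA : ∫ u in (-(T + 1))..(T + 1), ‖A u‖ ^ 2 ≤ M * S := by
    have h := dirichletPolynomial_meanSquare_le a N (T := T + 1) (by linarith)
    simpa [hM] using h
  have hbn : ∀ n ∈ Finset.Icc 1 N, ‖b n‖ ^ 2 ≤ Real.log N ^ 2 * ‖a n‖ ^ 2 := by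
    intro n hn
    simp only [Finset.mem_Icc] at hn
    have hn1 : (1 : ℝ) ≤ n := by exact_mod_cast hn.1
    have hnN : (n : ℝ) ≤ N := by exact_mod_cast hn.2
    have hl0 : 0 ≤ Real.log n := Real.log_nonneg hn1
    have hl : Real.log n ≤ Real.log N := Real.log_le_log (by linarith) hnN
    have e : ‖b n‖ = ‖a n‖ * Real.log n := by
      simp only [hb, norm_mul, norm_neg, Complex.norm_real, Complex.norm_I, mul_one,
        Real.norm_eq_abs, abs_of_nonneg hl0]
    rw [e, mul_pow]
    nlinarith [sq_nonneg (‖a n‖), mul_le_mul hl hl hl0 (hl0.trans hl)]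
  have hMB : ∫ u in (-(T + 1))..(T + 1), ‖B u‖ ^ 2 ≤ M * (Real.log N ^ 2 * S) := by
    have h := dirichletPolynomial_meanSquare_le b N (T := T + 1) (by linarith)
    have h' : ∑ n ∈ Finset.Icc 1 N, ‖b n‖ ^ 2 ≤ Real.log N ^ 2 * S := by
      rw [hS, Finset.mul_sum]
      exact Finset.sum_le_sum hbn
    calc ∫ u in (-(T + 1))..(T + 1), ‖B u‖ ^ 2 ≤ M * ∑ n ∈ Finset.Icc 1 N, ‖b n‖ ^ 2 := by
          simpa [hM] using h
      _ ≤ M * (Real.log N ^ 2 * S) := mul_le_mul_of_nonneg_left h' hM0.le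
  -- assemble
  have hsum : ∑ t ∈ 𝒯, ‖A t‖ ^ 2 ≤ (1 + L) * (M * S) + L⁻¹ * (M * (Real.log N ^ 2 * S)) := by
    calc ∑ t ∈ 𝒯, ‖A t‖ ^ 2
        ≤ ∑ t ∈ 𝒯, ((1 + L) * (∫ u in (t - 1 / 2)..(t + 1 / 2), ‖A u‖ ^ 2) +
            L⁻¹ * ∫ u in (t - 1 / 2)..(t + 1 / 2), ‖B u‖ ^ 2) := Finset.sum_le_sum fun t _ ↦ hG t
      _ = (1 + L) * ∑ t ∈ 𝒯, (∫ u in (t - 1 / 2)..(t + 1 / 2), ‖A u‖ ^ 2) +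
            L⁻¹ * ∑ t ∈ 𝒯, ∫ u in (t - 1 / 2)..(t + 1 / 2), ‖B u‖ ^ 2 := by
          rw [Finset.sum_add_distrib, Finset.mul_sum, Finset.mul_sum]
      _ ≤ (1 + L) * (∫ u in (-(T + 1))..(T + 1), ‖A u‖ ^ 2) +
            L⁻¹ * ∫ u in (-(T + 1))..(T + 1), ‖B u‖ ^ 2 := by
          gcongr
      _ ≤ (1 + L) * (M * S) + L⁻¹ * (M * (Real.log N ^ 2 * S)) := by
          gcongr
  -- numerical clean-up: `log N ≤ L`, `1 ≤ 2L`, `M ≤ 18 (T + N)`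
  have h1 : L⁻¹ * (M * (Real.log N ^ 2 * S)) ≤ L * (M * S) := by
    rw [inv_mul_le_iff₀ hL0]
    have : Real.log N ^ 2 * S ≤ L * L * S := by
      apply mul_le_mul_of_nonneg_right _ hS0
      nlinarith
    nlinarith [mul_nonneg hM0.le hS0]
  have h2 : M ≤ 18 * (T + N) := by rw [hM]; linarith
  have h3 : (1 : ℝ) ≤ 2 * L := by linarith
  have hMS : 0 ≤ M * S := mul_nonneg hM0.le hS0
  calc ∑ t ∈ 𝒯, ‖A t‖ ^ 2 ≤ (1 + L) * (M * S) + L * (M * S) := by linarith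
    _ = (1 + 2 * L) * (M * S) := by ring
    _ ≤ (4 * L) * (18 * (T + N) * S) := by
        apply mul_le_mul (by linarith) (mul_le_mul_of_nonneg_right h2 hS0) hMS (by linarith)
    _ = 72 * (T + N) * L * S := by ring

/-- **Matomäki–Radziwiłł 2016, Lemma 7 holds** (the named fact
`Literature.NumberTheory.LFunctions.MatomakiRadziwill2016_lemma7` of `DirichletPolynomialMeanValue.lean`, with `C = 72`).
[cite: MatomakiRadziwillAnnals2016, Lemma 7] -/
theorem MatomakiRadziwill2016_lemma7_holds : MatomakiRadziwill2016_lemma7 :=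
  ⟨72, fun N a T 𝒯 hN hT h𝒯 hsep ↦ by
    simpa [mul_assoc] using sum_norm_sq_dirichletPoly_le N a T 𝒯 hN hT h𝒯 hsep⟩

end Literature.NumberTheory.LFunctions
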